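import Literature.NumberTheory.LFunctions.RosserSchoenfeldVonMangoldtSum
import Literature.NumberTheory.Sieve.CoprimeSquarefreeSums
import Summits.RiemannHypothesis.RiemannHypothesis.Theses.WeilComb
import HarnessLib

/-!
# Route WeilComb — `CombHelsonBound` (item stmt-RiemannHypothesis-1027)

The Helson (von Mangoldt multiplicative-Toeplitz) bound

  `2 Re Σ_{m ≤ M} Σ_{n ≤ M/m} Λ(n) n^{-1/2} a(nm) conj(a(m)) ≤ (log M + 1) Σ_{m ≤ M} |a(m)|²`.

Proof (Collatz–Wielandt with the Perron weight `m^{-1/2}`, done termwise): by weighted AM–GM with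
weight `t = √n`,
`2 Re(Λ(n) n^{-1/2} a(nm) conj a(m)) ≤ Λ(n)|a(nm)|² + (Λ(n)/n)|a(m)|²`;
summing, the first part rearranges over `k = nm` (hyperbola rearrangement
`Literature.NumberTheory.Sieve.SquarefreeSums.sum_Icc_sum_divisorsAntidiagonal`) to
`Σ_k |a(k)|² Σ_{n ∣ k} Λ(n) = Σ_k |a(k)|² log k` (Mathlib `ArithmeticFunction.vonMangoldt_sum`), and
`log k + Σ_{n ≤ M/k} Λ(n)/n ≤ log k + log(M/k) + 1 = log M + 1` by the explicit Mertens bound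
`Σ_{n ≤ x} Λ(n)/n < log x + 1` (`x ≥ 1`) of Rosser–Schoenfeld 1962 ((3.24) with (2.8)), proved in
the tree as `Literature.NumberTheory.LFunctions.RosserSchoenfeld.sum_vonMangoldt_div_lt_log_add_one`.

Unconditional; standard axioms.
-/

-- `Summit.RiemannHypothesis.RiemannHypothesis.…` duplicates `RiemannHypothesis` BY DESIGN (D-0017, single-problem
-- summit); mirrors the Summits library option `weak.linter.dupNamespace = false` of `lakefile.toml`.
set_option linter.dupNamespace false

namespace Summit.RiemannHypothesis.RiemannHypothesis.Theorems

open Finset ArithmeticFunction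
open scoped ComplexConjugate

/-- Weighted AM–GM for the Hermitian pairing: `2 Re(z conj w) ≤ t|z|² + t⁻¹|w|²` for `t > 0`. -/
theorem WeilComb.two_mul_re_mul_conj_le (z w : ℂ) {t : ℝ} (ht : 0 < t) :
    2 * (z * conj w).re ≤ t * ‖z‖ ^ 2 + t⁻¹ * ‖w‖ ^ 2 := by
  rw [Complex.sq_norm, Complex.sq_norm, Complex.normSq_apply, Complex.normSq_apply,
    Complex.mul_re, Complex.conj_re, Complex.conj_im]
  have ht0 : t ≠ 0 := ht.ne'
  have key : 0 ≤ t * (z.re - t⁻¹ * w.re) ^ 2 + t * (z.im - t⁻¹ * w.im) ^ 2 := by positivity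
  have expand : t * (z.re - t⁻¹ * w.re) ^ 2 + t * (z.im - t⁻¹ * w.im) ^ 2 =
      t * (z.re * z.re + z.im * z.im) + t⁻¹ * (w.re * w.re + w.im * w.im)
        - 2 * (z.re * w.re - z.im * -w.im) := by
    field_simp
    ring
  linarith

/-- The termwise Perron-weight bound: for `n ≥ 1`,
`2 Re(Λ(n) n^{-1/2} z conj w) ≤ Λ(n)|z|² + (Λ(n)/n)|w|²` (AM–GM with weight `√n`). -/
theorem WeilComb.two_mul_re_vonMangoldt_term_le {n : ℕ} (hn : 1 ≤ n) (z w : ℂ) :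
    2 * (((Λ n : ℝ) : ℂ) / (Real.sqrt n : ℂ) * z * conj w).re ≤
      Λ n * ‖z‖ ^ 2 + Λ n / n * ‖w‖ ^ 2 := by
  have hn' : (0 : ℝ) < n := by exact_mod_cast hn
  have hs : 0 < Real.sqrt n := Real.sqrt_pos.2 hn'
  have hc : ((Λ n : ℝ) : ℂ) / (Real.sqrt n : ℂ) * z * conj w =
      ((Λ n / Real.sqrt n : ℝ) : ℂ) * (z * conj w) := by
    push_cast
    ring
  rw [hc, Complex.re_ofReal_mul]
  have h0 : 0 ≤ Λ n / Real.sqrt n := div_nonneg vonMangoldt_nonneg hs.le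
  have h1 := WeilComb.two_mul_re_mul_conj_le z w hs
  have e1 : Λ n / Real.sqrt n * Real.sqrt n = Λ n := div_mul_cancel₀ _ hs.ne'
  have e2 : Λ n / Real.sqrt n * (Real.sqrt n)⁻¹ = Λ n / n := by
    rw [← div_eq_mul_inv, div_div, Real.mul_self_sqrt hn'.le]
  calc 2 * (Λ n / Real.sqrt n * (z * conj w).re)
      = Λ n / Real.sqrt n * (2 * (z * conj w).re) := by ring
    _ ≤ Λ n / Real.sqrt n * (Real.sqrt n * ‖z‖ ^ 2 + (Real.sqrt n)⁻¹ * ‖w‖ ^ 2) :=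
        mul_le_mul_of_nonneg_left h1 h0
    _ = (Λ n / Real.sqrt n * Real.sqrt n) * ‖z‖ ^ 2 +
          (Λ n / Real.sqrt n * (Real.sqrt n)⁻¹) * ‖w‖ ^ 2 := by ring
    _ = Λ n * ‖z‖ ^ 2 + Λ n / n * ‖w‖ ^ 2 := by rw [e1, e2]

/-- The hyperbola rearrangement of the first AM–GM half:
`Σ_{m ≤ M} Σ_{n ≤ M/m} Λ(n)|a(nm)|² = Σ_{k ≤ M} |a(k)|² log k` (`Σ_{n ∣ k} Λ(n) = log k`). -/
theorem WeilComb.sum_sum_vonMangoldt_mul_norm_sq (M : ℕ) (a : ℕ → ℂ) :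
    ∑ m ∈ Icc 1 M, ∑ n ∈ Icc 1 (M / m), Λ n * ‖a (n * m)‖ ^ 2 =
      ∑ k ∈ Icc 1 M, ‖a k‖ ^ 2 * Real.log k := by
  rw [← Literature.NumberTheory.Sieve.SquarefreeSums.sum_Icc_sum_divisorsAntidiagonal
    (fun m n => Λ n * ‖a (n * m)‖ ^ 2) M]
  refine Finset.sum_congr rfl fun k _ => ?_
  have h : ∀ q ∈ k.divisorsAntidiagonal, Λ q.2 * ‖a (q.2 * q.1)‖ ^ 2 = ‖a k‖ ^ 2 * Λ q.2 := by
    intro q hq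
    rw [Nat.mem_divisorsAntidiagonal] at hq
    rw [mul_comm q.2 q.1, hq.1, mul_comm]
  rw [Finset.sum_congr rfl h, ← Finset.mul_sum]
  congr 1
  rw [Nat.sum_divisorsAntidiagonal' (fun _ e => Λ e)]
  exact vonMangoldt_sum

/-- The Collatz–Wielandt row sums: for `1 ≤ m ≤ M`,
`log m + Σ_{n ≤ M/m} Λ(n)/n ≤ log M + 1` (Rosser–Schoenfeld: `Σ_{n ≤ x} Λ(n)/n < log x + 1`). -/
theorem WeilComb.log_add_sum_vonMangoldt_div_le {M m : ℕ} (hm : m ∈ Icc 1 M) :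
    Real.log m + ∑ n ∈ Icc 1 (M / m), Λ n / n ≤ Real.log M + 1 := by
  have hm1 : 1 ≤ m := (Finset.mem_Icc.1 hm).1
  have hmM : m ≤ M := (Finset.mem_Icc.1 hm).2
  have hm0 : (0 : ℝ) < m := by exact_mod_cast hm1
  have hM0 : (0 : ℝ) < M := by exact_mod_cast (lt_of_lt_of_le hm1 hmM)
  have hmM' : (m : ℝ) ≤ M := by exact_mod_cast hmM
  have hx : (1 : ℝ) ≤ (M : ℝ) / m := by rwa [le_div_iff₀ hm0, one_mul]
  have key := Literature.NumberTheory.LFunctions.RosserSchoenfeld.sum_vonMangoldt_div_lt_log_add_one hx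
  rw [Nat.floor_div_eq_div, Real.log_div hM0.ne' hm0.ne'] at key
  have hI : Finset.Ioc 0 (M / m) = Finset.Icc 1 (M / m) := by
    ext x
    simp only [Finset.mem_Ioc, Finset.mem_Icc]
    omega
  rw [hI] at key
  linarith

/-- The bound in summed form:
`Σ_{m ≤ M} Σ_{n ≤ M/m} 2 Re(Λ(n) n^{-1/2} a(nm) conj a(m)) ≤ (log M + 1) Σ_{m ≤ M} |a(m)|²`. -/
theorem WeilComb.sum_sum_two_mul_re_le (M : ℕ) (a : ℕ → ℂ) :
    ∑ m ∈ Icc 1 M, ∑ n ∈ Icc 1 (M / m),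
        2 * (((Λ n : ℝ) : ℂ) / (Real.sqrt n : ℂ) * a (n * m) * conj (a m)).re ≤
      (Real.log M + 1) * ∑ m ∈ Icc 1 M, ‖a m‖ ^ 2 := by
  have h1 : ∑ m ∈ Icc 1 M, ∑ n ∈ Icc 1 (M / m),
        2 * (((Λ n : ℝ) : ℂ) / (Real.sqrt n : ℂ) * a (n * m) * conj (a m)).re ≤
      ∑ m ∈ Icc 1 M, ∑ n ∈ Icc 1 (M / m), (Λ n * ‖a (n * m)‖ ^ 2 + Λ n / n * ‖a m‖ ^ 2) :=
    Finset.sum_le_sum fun m _ => Finset.sum_le_sum fun n hn =>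
      WeilComb.two_mul_re_vonMangoldt_term_le (Finset.mem_Icc.1 hn).1 _ _
  have h2 : ∑ m ∈ Icc 1 M, ∑ n ∈ Icc 1 (M / m), (Λ n * ‖a (n * m)‖ ^ 2 + Λ n / n * ‖a m‖ ^ 2) =
      ∑ m ∈ Icc 1 M, ∑ n ∈ Icc 1 (M / m), Λ n * ‖a (n * m)‖ ^ 2 +
        ∑ m ∈ Icc 1 M, ‖a m‖ ^ 2 * ∑ n ∈ Icc 1 (M / m), Λ n / n := by
    rw [← Finset.sum_add_distrib]
    refine Finset.sum_congr rfl fun m _ => ?_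
    rw [Finset.sum_add_distrib, Finset.mul_sum]
    congr 1
    exact Finset.sum_congr rfl fun n _ => by ring
  refine h1.trans ?_
  rw [h2, WeilComb.sum_sum_vonMangoldt_mul_norm_sq, ← Finset.sum_add_distrib, Finset.mul_sum]
  refine Finset.sum_le_sum fun m hm => ?_
  have h4 := WeilComb.log_add_sum_vonMangoldt_div_le hm
  have h5 : 0 ≤ ‖a m‖ ^ 2 := by positivity
  calc ‖a m‖ ^ 2 * Real.log m + ‖a m‖ ^ 2 * ∑ n ∈ Icc 1 (M / m), Λ n / n
      = ‖a m‖ ^ 2 * (Real.log m + ∑ n ∈ Icc 1 (M / m), Λ n / n) := by ring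
    _ ≤ ‖a m‖ ^ 2 * (Real.log M + 1) := mul_le_mul_of_nonneg_left h4 h5
    _ = (Real.log M + 1) * ‖a m‖ ^ 2 := by ring

/-- **`CombHelsonBound`** (route WeilComb, item stmt-RiemannHypothesis-1027): for every `M ≥ 1` and
`a : ℕ → ℂ`,
`2 Re Σ_{m ≤ M} Σ_{n ≤ M/m} Λ(n) n^{-1/2} a(nm) conj a(m) ≤ (log M + 1) Σ_{m ≤ M} |a(m)|²`
(Collatz–Wielandt with Perron weight `m^{-1/2}`; Rosser–Schoenfeld's explicit Mertens bound supplies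
the constant `1`). Unconditional. -/
theorem combHelsonBound_proof :
    Summit.RiemannHypothesis.RiemannHypothesis.Theses.WeilComb.CombHelsonBound := by
  unfold Summit.RiemannHypothesis.RiemannHypothesis.Theses.WeilComb.CombHelsonBound
  intro M a _hM
  have hre : 2 * (∑ m ∈ Icc 1 M, ∑ n ∈ Icc 1 (M / m),
      ((Λ n : ℝ) : ℂ) / (Real.sqrt n : ℂ) * a (n * m) * conj (a m)).re =
      ∑ m ∈ Icc 1 M, ∑ n ∈ Icc 1 (M / m),
        2 * (((Λ n : ℝ) : ℂ) / (Real.sqrt n : ℂ) * a (n * m) * conj (a m)).re := by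
    rw [Complex.re_sum, Finset.mul_sum]
    exact Finset.sum_congr rfl fun m _ => by rw [Complex.re_sum, Finset.mul_sum]
  rw [hre]
  exact WeilComb.sum_sum_two_mul_re_le M a

end Summit.RiemannHypothesis.RiemannHypothesis.Theorems
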